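import Literature.Probability.RandomPlanarGeometry.SmoothHitPathSteps
import Literature.Probability.RandomPlanarGeometry.SLERestrictionHitPathAccess
import HarnessLib

/-!
# Discharge of `IsSmoothHullWith.exists_smoothHitPath`: the inward normal segment

The named fact `IsSmoothHullWith.exists_smoothHitPath` (`SLERestrictionHitPathAccess`) is PROVED
(`IsSmoothHullWith.exists_smoothHitPath_holds`): at a point `z₀ = γ(s₀)` of the boundary arc of
a smooth hull `A`, for one of the two normal directions `± i γ'(s₀)` the normal segment
`β(x) = z₀ ± (1 - x) ℓ i γ'(s₀)`, `ℓ` small, is an injective smooth hit path: `β[0,1) ⊆ int A`.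

Proof (elementary; `SmoothArcLocal`, `SmoothHitPathSteps`): in the tangential/normal
coordinates at `z₀`, arc points within `3h` of `z₀` have small normal coordinate and are
graph-like (at most one per normal line); an interior point `w` of `A` near `z₀`
(`IsArcHull.frontier_subset_closure_interior`) is joined — by a normal step then a tangential
step, both missing the arc — to a point `w₂` of one of the two normal segments at `z₀`, which
therefore lies in `int A` (`subset_interior_of_disjoint_arc`); the open normal segment through
`w₂` misses the arc as well, so it lies in `int A` entirely.
-/

noncomputable section

open Set Filter Metric Complex Function
open _root_.Topology
open UpperHalfPlane (upperHalfPlaneSet isOpen_upperHalfPlaneSet)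
open scoped unitInterval ComplexConjugate

namespace Literature.Probability.RandomPlanarGeometry

/-- **Discharge of the named fact `IsSmoothHullWith.exists_smoothHitPath`**: an injective smooth
hit path exists at every point of the boundary arc of a smooth hull (a normal segment).
[folklore] -/
theorem IsSmoothHullWith.exists_smoothHitPath_holds : IsSmoothHullWith.exists_smoothHitPath := by
  intro A γ γ' hAw s₀ hs₀
  have hAw' := hAw
  obtain ⟨hA, hγ, hγ'c, hγ'ne, hinj, -, -, hIoo, hfrA⟩ := hAw'
  have hAarc : IsArcHull A := hAw.isSmoothHull.isArcHull
  have hs₀I : s₀ ∈ Icc (0 : ℝ) 1 := ⟨hs₀.1.le, hs₀.2.le⟩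
  set z₀ : ℂ := γ s₀ with hz₀
  set v : ℂ := γ' s₀ with hvdef
  have hv : v ≠ 0 := hγ'ne s₀ hs₀I
  have hν : 0 < ‖v‖ := norm_pos_iff.2 hv
  have hz₀H : 0 < z₀.im := hIoo s₀ hs₀
  have hz₀fr : z₀ ∈ frontier A := (hAw.apply_mem_frontier hs₀).2
  have hγc : ContinuousOn γ (Icc 0 1) := fun t ht ↦ (hγ t ht).continuousWithinAt
  -- local data at `s₀`
  obtain ⟨κ₁, hκ₁, hcone⟩ := exists_cone_of_hasDerivWithinAt (hγ s₀ hs₀I) hv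
  obtain ⟨κ₂, hκ₂, hmono⟩ := exists_strictMonoOn_tangential hs₀I hγ hγ'c hv
  obtain ⟨κ, hκ, hκ₁', hκ₂'⟩ : ∃ κ : ℝ, 0 < κ ∧ κ ≤ κ₁ ∧ κ ≤ κ₂ :=
    ⟨min κ₁ κ₂, lt_min hκ₁ hκ₂, min_le_left _ _, min_le_right _ _⟩
  obtain ⟨d₀, hd₀, hfar⟩ := exists_pos_le_norm_sub_of_far hγc hinj hs₀I hκ
  obtain ⟨h, hh, h3d, h3im⟩ : ∃ h : ℝ, 0 < h ∧ 3 * h < d₀ ∧ 3 * h < z₀.im :=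
    ⟨min d₀ z₀.im / 4, by positivity, by linarith [min_le_left d₀ z₀.im], by linarith [min_le_right d₀ z₀.im]⟩
  -- consequences
  have hnear : ∀ s ∈ Icc (0 : ℝ) 1, ‖γ s - z₀‖ < 3 * h → |s - s₀| < κ := fun s hs hclose ↦ by
    by_contra hge
    rw [not_lt] at hge
    linarith [hfar s hs hge]
  have hnear_cone : ∀ s ∈ Icc (0 : ℝ) 1, ‖γ s - z₀‖ < 3 * h →
      |((γ s - z₀) * conj v).im| ≤ |((γ s - z₀) * conj v).re| / 2 := fun s hs hclose ↦
    (hcone s hs (lt_of_lt_of_le (hnear s hs hclose) hκ₁')).1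
  have huniq : ∀ s ∈ Icc (0 : ℝ) 1, ∀ s' ∈ Icc (0 : ℝ) 1, |s - s₀| < κ → |s' - s₀| < κ →
      ((γ s - z₀) * conj v).re = ((γ s' - z₀) * conj v).re → s = s' := by
    intro s hs s' hs' hsκ hs'κ heq
    have hmem : ∀ u ∈ Icc (0 : ℝ) 1, |u - s₀| < κ → u ∈ Icc (0 : ℝ) 1 ∩ Icc (s₀ - κ₂) (s₀ + κ₂) := fun u hu huκ ↦
      ⟨hu, ⟨by linarith [(abs_lt.1 huκ).1], by linarith [(abs_lt.1 huκ).2]⟩⟩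
    exact hmono.injOn (hmem s hs hsκ) (hmem s' hs' hs'κ) heq
  have hballH : ball z₀ (3 * h) ⊆ upperHalfPlaneSet := fun z hz ↦ by
    show 0 < z.im
    rw [mem_ball, dist_eq_norm] at hz
    have h1 := Complex.abs_im_le_norm (z - z₀)
    rw [Complex.sub_im] at h1
    linarith [(abs_lt.1 (lt_of_le_of_lt h1 hz)).1]
  have havoid : ∀ z ∈ ball z₀ (3 * h), |((z - z₀) * conj v).re| / 2 < |((z - z₀) * conj v).im| →
      z ∉ γ '' Icc 0 1 := by
    rintro z hz hNz ⟨s, hs, rfl⟩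
    rw [mem_ball, dist_eq_norm] at hz
    linarith [hnear_cone s hs hz]
  have hcoordball : ∀ z : ℂ, |((z - z₀) * conj v).re| + |((z - z₀) * conj v).im| < 3 * h * ‖v‖ →
      z ∈ ball z₀ (3 * h) := fun z hz ↦ by
    rw [mem_ball, dist_eq_norm]
    have h1 := norm_mul_le_abs_coord z z₀ v
    exact lt_of_mul_lt_mul_right (lt_of_le_of_lt h1 hz) hν.le
  -- an interior point `w` near `z₀`
  obtain ⟨w, hwball, hwint⟩ : ∃ w ∈ ball z₀ h, w ∈ interior A := by
    have hcl := hAarc.frontier_subset_closure_interior ⟨hz₀H, hz₀fr⟩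
    rw [mem_closure_iff_nhds] at hcl
    obtain ⟨w, hw1, hw2⟩ := hcl (ball z₀ h) (ball_mem_nhds z₀ hh)
    exact ⟨w, hw1, hw2⟩
  have hwγ : w ∉ γ '' Icc 0 1 := by
    rintro ⟨s, hs, hse⟩
    have hwH : 0 < w.im := hA.interior_subset hwint
    rcases hs.1.eq_or_lt with h0 | h0
    · rw [← h0] at hse; rw [← hse, hAw.2.2.2.2.2.1] at hwH; exact lt_irrefl _ hwH
    rcases hs.2.eq_or_lt with h1 | h1
    · rw [h1] at hse; rw [← hse, hAw.2.2.2.2.2.2.1] at hwH; exact lt_irrefl _ hwH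
    · have hfr : γ s ∈ upperHalfPlaneSet ∩ frontier A := by rw [hfrA]; exact ⟨s, ⟨h0, h1⟩, rfl⟩
      rw [hse] at hfr
      exact (disjoint_interior_frontier (s := A)).le_bot ⟨hwint, hfr.2⟩
  have hwnorm : ‖w - z₀‖ < h := by rwa [mem_ball, dist_eq_norm] at hwball
  have hTw : |((w - z₀) * conj v).re| < h * ‖v‖ := by
    refine lt_of_le_of_lt (Complex.abs_re_le_norm _) ?_
    rw [norm_mul, Complex.norm_conj]; exact mul_lt_mul_of_pos_right hwnorm hν
  have hNw : |((w - z₀) * conj v).im| < h * ‖v‖ := by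
    refine lt_of_le_of_lt (Complex.abs_im_le_norm _) ?_
    rw [norm_mul, Complex.norm_conj]; exact mul_lt_mul_of_pos_right hwnorm hν
  -- the vertical step
  obtain ⟨sg, hsg, w₁, hTw₁, hNw₁, hseg₁ball, hseg₁γ⟩ := exists_vertical_step hv hnear huniq hwγ hTw hNw
  have hsg0 : sg ≠ 0 := by rcases hsg with h | h <;> rw [h] <;> norm_num
  have hsgabs : |sg| = 1 := by rcases hsg with h | h <;> rw [h] <;> norm_num
  -- the normal segment map and the target point `w₂`
  set nmap : ℝ → ℂ := fun t ↦ z₀ + ((sg * t : ℝ) : ℂ) * (Complex.I * v) with hnmap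
  have hnT : ∀ t, ((nmap t - z₀) * conj v).re = 0 := fun t ↦ by
    have := re_coord_add_mul_I_mul z₀ z₀ v (sg * t)
    simp only [hnmap]
    rw [this, sub_self, zero_mul, Complex.zero_re]
  have hnN : ∀ t, ((nmap t - z₀) * conj v).im = sg * t * ‖v‖ ^ 2 := fun t ↦ by
    have := im_coord_add_mul_I_mul z₀ z₀ v (sg * t)
    simp only [hnmap]
    rw [this, sub_self, zero_mul, Complex.zero_im, zero_add]
  have hnball : ∀ t, 0 < t → t < 3 * h / ‖v‖ → nmap t ∈ ball z₀ (3 * h) := fun t ht0 ht ↦ by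
    refine hcoordball _ ?_
    rw [hnT, hnN, abs_zero, zero_add, abs_mul, abs_mul, hsgabs, one_mul, abs_of_pos ht0,
      abs_of_pos (by positivity)]
    rw [lt_div_iff₀ hν] at ht
    nlinarith
  have hnavoid : ∀ t, 0 < t → t < 3 * h / ‖v‖ → nmap t ∉ γ '' Icc 0 1 := fun t ht0 ht ↦ by
    refine havoid _ (hnball t ht0 ht) ?_
    rw [hnT, hnN, abs_zero, zero_div, abs_mul, abs_mul, hsgabs, one_mul, abs_of_pos ht0,
      abs_of_pos (by positivity)]
    positivity
  set ℓ : ℝ := 2 * h / ‖v‖ with hℓ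
  have hℓpos : 0 < ℓ := by positivity
  have hℓlt : ℓ < 3 * h / ‖v‖ := by rw [hℓ]; exact div_lt_div_of_pos_right (by linarith) hν
  set w₂ : ℂ := nmap ℓ with hw₂
  have hNw₂ : ((w₂ - z₀) * conj v).im = sg * (2 * h * ‖v‖) := by
    rw [hw₂, hnN, hℓ]; field_simp
  have hTw₂ : ((w₂ - z₀) * conj v).re = 0 := hnT ℓ
  -- the horizontal segment from `w₁` to `w₂`
  have hseg₂ : ∀ p ∈ segment ℝ w₁ w₂, ((p - z₀) * conj v).im = sg * (2 * h * ‖v‖) ∧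
      |((p - z₀) * conj v).re| ≤ |((w - z₀) * conj v).re| := by
    intro p hp
    rw [segment_eq_image'] at hp
    obtain ⟨θ, hθ, rfl⟩ := hp
    have hexp : (w₁ + θ • (w₂ - w₁) - z₀) * conj v =
        (1 - (θ : ℂ)) * ((w₁ - z₀) * conj v) + (θ : ℂ) * ((w₂ - z₀) * conj v) := by
      rw [Complex.real_smul]; ring
    have key_im : ∀ (X₁ X₂ : ℂ) (t : ℝ), ((1 - (t : ℂ)) * X₁ + (t : ℂ) * X₂).im = (1 - t) * X₁.im + t * X₂.im := by
      intro X₁ X₂ t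
      simp only [Complex.add_im, Complex.mul_im, Complex.sub_re, Complex.one_re, Complex.ofReal_re, Complex.sub_im,
        Complex.one_im, Complex.ofReal_im, sub_zero, zero_mul, add_zero]
    have key_re : ∀ (X₁ X₂ : ℂ) (t : ℝ), ((1 - (t : ℂ)) * X₁ + (t : ℂ) * X₂).re = (1 - t) * X₁.re + t * X₂.re := by
      intro X₁ X₂ t
      simp only [Complex.add_re, Complex.mul_re, Complex.sub_re, Complex.one_re, Complex.ofReal_re, Complex.sub_im,
        Complex.one_im, Complex.ofReal_im, sub_zero, zero_mul, sub_zero]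
    constructor
    · rw [hexp, key_im, hNw₁, hNw₂]
      ring
    · rw [hexp, key_re, hTw₁, hTw₂, mul_zero, add_zero, abs_mul, abs_of_nonneg (by linarith [hθ.2])]
      nlinarith [abs_nonneg ((w - z₀) * conj v).re, hθ.1, hθ.2]
  have hseg₂ball : segment ℝ w₁ w₂ ⊆ ball z₀ (3 * h) := fun p hp ↦ by
    obtain ⟨hN, hT⟩ := hseg₂ p hp
    refine hcoordball _ ?_
    rw [hN, abs_mul, hsgabs, one_mul, abs_of_pos (mul_pos (mul_pos two_pos hh) hν)]
    linarith
  have hseg₂γ : Disjoint (segment ℝ w₁ w₂) (γ '' Icc 0 1) := by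
    rw [Set.disjoint_left]
    intro p hp
    obtain ⟨hN, hT⟩ := hseg₂ p hp
    refine havoid _ (hseg₂ball hp) ?_
    rw [hN, abs_mul, hsgabs, one_mul, abs_of_pos (mul_pos (mul_pos two_pos hh) hν)]
    have h1 : |((w - z₀) * conj v).re| < h * ‖v‖ := hTw
    nlinarith [mul_pos hh hν]
  -- the path `[w, w₁] ∪ [w₁, w₂]` lies in `int A`, hence so does `w₂`
  have hw₂int : w₂ ∈ interior A := by
    have hsub : segment ℝ w w₁ ∪ segment ℝ w₁ w₂ ⊆ interior A := by
      refine subset_interior_of_disjoint_arc hfrA ?_ ?_ ?_ ⟨w, Or.inl (left_mem_segment ℝ w w₁), hwint⟩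
      · exact IsPreconnected.union w₁ (right_mem_segment ℝ w w₁) (left_mem_segment ℝ w₁ w₂)
          (convex_segment w w₁).isPreconnected (convex_segment w₁ w₂).isPreconnected
      · exact union_subset (hseg₁ball.trans hballH) (hseg₂ball.trans hballH)
      · exact Set.disjoint_union_left.2 ⟨hseg₁γ, hseg₂γ⟩
    exact hsub (Or.inr (right_mem_segment ℝ w₁ w₂))
  -- the open normal segment lies in `int A`
  have hnint : nmap '' Ioo 0 (3 * h / ‖v‖) ⊆ interior A := by
    refine subset_interior_of_disjoint_arc hfrA ?_ ?_ ?_ ⟨w₂, ⟨ℓ, ⟨hℓpos, hℓlt⟩, rfl⟩, hw₂int⟩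
    · refine (isPreconnected_Ioo.image _ ?_)
      exact (continuous_const.add ((Complex.continuous_ofReal.comp (continuous_const.mul continuous_id)).mul
        continuous_const)).continuousOn
    · rintro _ ⟨t, ht, rfl⟩; exact hballH (hnball t ht.1 ht.2)
    · rw [Set.disjoint_left]; rintro _ ⟨t, ht, rfl⟩; exact hnavoid t ht.1 ht.2
  -- the hit path
  set β : ℝ → ℂ := fun x ↦ nmap ((1 - x) * ℓ) with hβ
  set c₀ : ℝ := sg * ((0 - 1) * ℓ) with hc₀
  set β' : ℝ → ℂ := fun _ ↦ (c₀ : ℂ) * (Complex.I * v) with hβ'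
  have hderiv : ∀ x, HasDerivAt β ((c₀ : ℂ) * (Complex.I * v)) x := by
    intro x
    have h1 : HasDerivAt (fun y : ℝ ↦ sg * ((1 - y) * ℓ)) c₀ x := by
      have := (((hasDerivAt_id x).const_sub 1).mul_const ℓ).const_mul sg
      simpa [hc₀] using this
    have h2 := ((h1.ofReal_comp).mul_const (Complex.I * v)).const_add z₀
    exact h2
  refine ⟨β, β', ⟨fun x _ ↦ (hderiv x).hasDerivWithinAt, continuousOn_const, ?_, ?_, ?_, ?_⟩, ?_⟩
  · -- `β' 1 ≠ 0`
    simp only [hβ']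
    refine mul_ne_zero ?_ (mul_ne_zero Complex.I_ne_zero hv)
    rw [Complex.ofReal_ne_zero, hc₀]
    exact mul_ne_zero hsg0 (mul_ne_zero (by norm_num) hℓpos.ne')
  · -- interior on `[0, 1)`
    intro x hx
    refine hnint ⟨(1 - x) * ℓ, ⟨mul_pos (by linarith [hx.2]) hℓpos, ?_⟩, rfl⟩
    calc (1 - x) * ℓ ≤ 1 * ℓ := by gcongr; linarith [hx.1]
      _ < 3 * h / ‖v‖ := by rw [one_mul]; exact hℓlt
  · -- `β 1 = γ s₀`
    simp [hβ, hnmap, hz₀]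
  · -- orthogonality at the endpoint
    simp only [hβ']
    have h1 : (c₀ : ℂ) * (Complex.I * v) * conj (γ' s₀) = (c₀ : ℂ) * Complex.I * (v * conj v) := by
      rw [hvdef]; ring
    rw [h1, mul_conj_eq_norm_sq,
      show (c₀ : ℂ) * Complex.I * (((‖v‖ ^ 2 : ℝ)) : ℂ) = ((c₀ * ‖v‖ ^ 2 : ℝ) : ℂ) * Complex.I by push_cast; ring,
      Complex.re_ofReal_mul, Complex.I_re, mul_zero]
  · -- injectivity
    intro x _ y _ hxy
    simp only [hβ, hnmap] at hxy
    have h1 := mul_right_cancel₀ (mul_ne_zero Complex.I_ne_zero hv) (add_left_cancel hxy)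
    have h2 : sg * ((1 - x) * ℓ) = sg * ((1 - y) * ℓ) := by exact_mod_cast h1
    have h3 := mul_left_cancel₀ hsg0 h2
    have h4 := mul_right_cancel₀ hℓpos.ne' h3
    linarith

end Literature.Probability.RandomPlanarGeometry
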